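import Literature.MathematicalPhysics.QuantumFieldTheory.Balaban1983to89.B16Ineq382VPrime

/-!
# `Balaban1983to89.B16Ineq382Case1` — T. Bałaban, *Large field renormalization. II. Localization, exponentiation, and bounds for the 𝐑 operation*, Commun. Math. Phys. **122** (1989) 355–392 [Balaban1989LargeFieldII], p. 382, case 1 of the factor `1 − χ′` ASSEMBLED at object level: *"hence we have |B′(b)| < 12R_j⁴ε + 1/2δ′_j. If we take ε = (24R_j⁴)⁻¹δ′_j, then |B′(b)| < δ′_j. This implies that at least one plaquette variable has to satisfy the opposite inequality, i.e., |V″(∂p′) − 1| ≧ (24R_j⁴)⁻¹δ′_j for some p′ ⊂ Ω″^{~2}_{h+1}∖Ω″_{h+1}"* — PROVED from PART 3's `V′(b)` chain and r13's arithmetic `B16Sect1Statements.prep382_eps_choice` (PART 5 of the case-1 estimate; PARTS 1–4 = `B16Ineq382Stokes`, `B16Ineq382Cases`/`B16Ineq382TreeGauge`, `B16Ineq382VPrime`, `B16Ineq382AxialSlice`)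

statement-level skeleton of published theorems with citation tags; proofs where landed; nothing here is a claim about the Yang–Mills mass gap

PDF held: `paper:balaban1989-cmp122-large-field-ii` (journal page = PDF page + 354; pp. 381–382 = PDF pp. 27–28,
re-read AS IMAGES: `run/shared/lean/pub/pub-balaban/b2b-balaban-ref1/pages/1989-cmp122-large-field-II/…-p027-x2.png`,
`…-p028-x2.png`); [IV] = `paper:balaban1989-cmp122-large-field-i` (p. 196 = PDF p. 22: (1.82) `χ′ = χ({|B′(b)| < δ′_k
for b ∈ 𝔹₀})`, `V′ = exp iB′`, and *"We can prove that it satisfies |V′ − 1| < O(1)M²NR_k⁴ε_k on 𝔹₀"*).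

WHAT IS REPRODUCED (mega-formalization `lit-balaban`, HOME `run/shared/lean/pub/lit-balaban/`, Phase-2 seat p26,
generation 3; SKELETON row **B16.Lem@381** (r13: `B16Sect1Statements` §12 typed the arithmetic — `Ineq382V'`,
`prep382_eps_choice`, `prep382_case1_factor`), referee ref-5).  P. 381–382 (renders re-read): *"The restrictions
introduced by the function 1 − χ′ mean that at least one bond variable B′(b), b ∈ 𝔹₀, satisfies the inequality
|B′(b)| ≧ δ′_j … In the first case we assume that b ⊂ Ω″^{~2}_{h+1}∖Ω″_{h+1} … Assume that the plaquette variables of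
V″ on this domain are small, i.e., |V″(∂p′) − 1| < ε for p′ ⊂ Ω″^{~2}_{h+1}∖Ω″_{h+1} … From the above estimates we
obtain |V′(b) − 1| < 6(100M(L + 1)R_j^{1+β₀})²ε + O(1)(A₀/A₁)B₃²B₅M⁷R_j^{1+β₀}(p₀(g_j)/p₁(g_j))L^{−N}δ′_j. By our
assumptions on N the number multiplying δ′_j is small, e.g., it is smaller than 1/4, hence we have |B′(b)| < 12R_j⁴ε
+ 1/2δ′_j. If we take ε = (24R_j⁴)⁻¹δ′_j, then |B′(b)| < δ′_j. This implies that at least one plaquette variable has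
to satisfy the opposite inequality, i.e., |V″(∂p′) − 1| ≧ (24R_j⁴)⁻¹δ′_j for some p′ ⊂ Ω″^{~2}_{h+1}∖Ω″_{h+1}."*

THE TYPING / WHAT IS PROVED.  §13 `norm_le_two_mul_norm_exp_sub_one`: `‖B‖ ≤ 2‖e^B − 1‖` for `‖B‖ ≤ 1/2` in a
complete normed `ℂ`-algebra (the comparison between `|B′(b)|` and `|V′(b) − 1|`, `V′ = exp iB′`, with the `i`
absorbed into `B` as in the tree's `B7Prop1Explicit`).  §14 `prep382_normB_lt`: the printed *"hence |B′(b)| < 12R_j⁴ε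
+ 1/2δ′_j"* from PART 3's typed conclusion `Ineq382V' dev …`, `|B′(b)| ≤ 2·dev`, the printed smallness *"the number
multiplying δ′_j … smaller than 1/4"*, and `(100M(L + 1)R_j^{1+β₀})² ≦ R_j⁴` (pure arithmetic).  §15 `Case1Setup` =
PART 3's `FluctHyp` WITHOUT the plaquette assumption (the assumption to be contradicted) and without `ε`;
`Case1Setup.fluctHyp`; **`Case1Setup.normB_lt_delta`**: if all plaquettes of `V″ = V′V₀` with corners in `P₁∖P₂`
are `≤ ε = (24R_j⁴)⁻¹δ′_j` then EVERY bond `b` of `P₁∖P₂` has `‖B′(b)‖ < δ′_j` (PART 3's `FluctHyp.ineq382V'` ∘ §14 ∘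
r13's `prep382_eps_choice` BY NAME); **`Case1Setup.exists_large_plaquette`**: if some bond `b` of `P₁∖P₂` has
`‖B′(b)‖ ≥ δ′_j` (the restriction of `1 − χ′`, case 1) then some plaquette `p′` with corners in `P₁∖P₂` has
`‖V″(∂p′) − 1‖ > (24R_j⁴)⁻¹δ′_j` — the printed conclusion feeding the Wilson factor `prep382_case1_factor`.

HONEST SCOPE / DEVIATIONS.  (1) As PARTS 1–3 (one annulus of `ℤ^{n+3}`, `U1 𝔸`-valued fields, the (1.87) [IV] input
on `V₀` as the hypothesis `η ≤ K·B₃²B₅M⁶(L⁻¹)^N ε_j`, `R′ ≤ (L + 1)R_j^{1+β₀}`, explicit `C = 100(2d + 3)(L + 1)K`).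
(2) `V′(b) = e^{B′(b)}` with `‖B′(b)‖ ≤ 1/2` on the bonds of `P₁∖P₂` is a HYPOTHESIS (the print's regularity `|V′ − 1|
< O(1)M²NR_k⁴ε_k` of [IV] p. 196, small); it gives `|B′(b)| ≤ 2|V′(b) − 1|`, the factor `2` being absorbed as
follows.  (3) NOT PRINTED and taken as explicit hypotheses: `(100M(L + 1)R_j^{1+β₀})² ≦ R_j⁴` (the passage from
`6(100M(L + 1)R_j^{1+β₀})²ε` to `12R_j⁴ε`; cell ledger HOME/GAPS.md G-B16-p26-01, a reading note — nothing fails) and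
the printed *"smaller than 1/4"* for the coefficient `C(A₀/A₁)B₃²B₅M⁷R_j^{1+β₀}(p₀/p₁)L^{−N}` of `δ′_j`.  (4) With
`≤ ε`-hypotheses the contrapositive yields the strict `> ε` where the print (with `< ε`) writes `≧`.  Every
declaration is a definition with a body or a proved theorem; nothing of [IV]/[V] is asserted as a hypothesis-free
fact.  Unit `lit-balaban-p26` (literature-prover-lit-balaban-p26-g3-0).
-/

noncomputable section

open scoped BigOperators

namespace Literature.MathematicalPhysics.QuantumFieldTheory.Balaban1983to89.B16Ineq382

open B7Prop1Explicit B8Lemma1NonAbelian B15TreeGauge196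

/-! ## §13 `|B′(b)|` versus `|V′(b) − 1|` for `V′ = exp iB′` ([IV] (1.82)) -/

section LieComparison

variable {𝔸 : Type*} [NormedRing 𝔸] [NormedAlgebra ℂ 𝔸] [CompleteSpace 𝔸]

open NormedSpace

/-- **`‖B‖ ≤ 2‖e^B − 1‖` for `‖B‖ ≤ 1/2`** (from `‖e^B − 1 − B‖ ≤ ρ(‖B‖) ≤ ‖B‖²`): the comparison between the bond
variable `B′(b)` of (1.82) [IV] and `V′(b) − 1`, `V′ = exp iB′`, used on p. 382 to pass from `|V′(b) − 1|` to
`|B′(b)|`. [cite: Balaban1989LargeFieldII, p.382] -/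
theorem norm_le_two_mul_norm_exp_sub_one {B : 𝔸} (h : ‖B‖ ≤ 1 / 2) : ‖B‖ ≤ 2 * ‖exp B - 1‖ := by
  have h2 := (norm_exp_sub_one_le_of_norm_le (le_refl ‖B‖)).2
  have h3 : expRem ‖B‖ ≤ ‖B‖ ^ 2 := expRem_le_sq (norm_nonneg _) (by linarith)
  have h4 : ‖B‖ ≤ ‖exp B - 1‖ + ‖exp B - 1 - B‖ := by
    have e : B = (exp B - 1) - (exp B - 1 - B) := by abel
    calc ‖B‖ = ‖(exp B - 1) - (exp B - 1 - B)‖ := by rw [← e]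
      _ ≤ ‖exp B - 1‖ + ‖exp B - 1 - B‖ := norm_sub_le _ _
  nlinarith [norm_nonneg B, norm_nonneg (exp B - 1)]

end LieComparison

/-! ## §14 p. 382: "hence we have |B′(b)| < 12R_j⁴ε + 1/2δ′_j" (arithmetic) -/

section Arith

/-- **p. 382: "By our assumptions on N the number multiplying δ′_j is small, e.g., it is smaller than 1/4, hence we
have |B′(b)| < 12R_j⁴ε + 1/2δ′_j"** — from the typed `V′(b)` estimate `Ineq382V' dev …` (PART 3 discharges it),
`|B′(b)| ≤ 2·dev` (§13), the printed smallness of the coefficient of `δ′_j` (`≤ 1/4`), and `(100M(L + 1)R_j^{1+β₀})²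
≦ R_j⁴` (not printed; GAPS G-B16-p26-01): exactly the hypothesis of r13's `B16Sect1Statements.prep382_eps_choice`.
[cite: Balaban1989LargeFieldII, p.382] -/
theorem prep382_normB_lt {nB dev M L Rj β₀ ε C A₀ A₁ B₃ B₅ p₀g p₁g Linv δ'j : ℝ} {N : ℕ}
    (hdev : B16Sect1Statements.Ineq382V' dev M L Rj β₀ ε C A₀ A₁ B₃ B₅ p₀g p₁g Linv N δ'j) (hB : nB ≤ 2 * dev)
    (hsmall : C * (A₀ / A₁) * B₃ ^ 2 * B₅ * M ^ 7 * Rj ^ (1 + β₀) * (p₀g / p₁g) * Linv ^ N ≤ 1 / 4)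
    (hR4 : (100 * M * (L + 1) * Rj ^ (1 + β₀)) ^ 2 ≤ Rj ^ 4) (hε : 0 ≤ ε) (hδ : 0 ≤ δ'j) :
    nB < 12 * Rj ^ 4 * ε + 1 / 2 * δ'j := by
  unfold B16Sect1Statements.Ineq382V' at hdev
  have h1 : 6 * (100 * M * (L + 1) * Rj ^ (1 + β₀)) ^ 2 * ε ≤ 6 * Rj ^ 4 * ε :=
    mul_le_mul_of_nonneg_right (mul_le_mul_of_nonneg_left hR4 (by norm_num)) hε
  have h2 : C * (A₀ / A₁) * B₃ ^ 2 * B₅ * M ^ 7 * Rj ^ (1 + β₀) * (p₀g / p₁g) * Linv ^ N * δ'j ≤ 1 / 4 * δ'j :=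
    mul_le_mul_of_nonneg_right hsmall hδ
  linarith

end Arith

/-! ## §15 p. 382, case 1 assembled: small plaquettes ⇒ `|B′(b)| < δ′_j` on every bond; contrapositive -/

section Case1

variable {d : ℕ} {n : ℕ} {𝔸 : Type*} [NormedRing 𝔸] [NormOneClass 𝔸]

/-- **The situation of p. 381, case 1, BEFORE the plaquette assumption** (= PART 3's `FluctHyp` without `plaq` and
`ε`): the annulus `P₁∖P₂` with its geometry and side bound, `U1`-valued `V′` (on the tree-gauge slice of [IV] p. 196)
and `V₀` (with the p. 382 bond input `|V₀(b) − 1| ≤ η`). [cite: Balaban1989LargeFieldII, p.381] -/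
structure Case1Setup (lo hi lo' hi' : Site (n + 3)) (τ : ℤ) (W : ℕ) (V' V₀ : Site (n + 3) → Fin (n + 3) → 𝔸ˣ)
    (η : ℝ) : Prop where
  geom : Geom lo hi lo' hi' τ
  width : ∀ κ, hi κ - lo κ ≤ W
  unit' : ∀ x κ, V' x κ ∈ U1 𝔸
  unit₀ : ∀ x κ, V₀ x κ ∈ U1 𝔸
  eta_nonneg : 0 ≤ η
  tree : ∀ x ∈ ann lo hi lo' hi', BondsOneAlong V' lo (contour lo hi τ x)
  bond₀ : BondSmallOn (ann lo hi lo' hi') V₀ η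

variable {lo hi lo' hi' : Site (n + 3)} {τ : ℤ} {W : ℕ} {V' V₀ : Site (n + 3) → Fin (n + 3) → 𝔸ˣ} {η ε : ℝ}

/-- p. 381: *"Assume that the plaquette variables of V″ on this domain are small, i.e., |V″(∂p′) − 1| < ε"* — adding
the plaquette assumption gives PART 3's `FluctHyp`. [cite: Balaban1989LargeFieldII, p.381] -/
theorem Case1Setup.fluctHyp (S : Case1Setup lo hi lo' hi' τ W V' V₀ η) (hε : 0 ≤ ε)
    (hP : PlaqSmallOn (ann lo hi lo' hi') (mulCfg V' V₀) ε) : FluctHyp lo hi lo' hi' τ W V' V₀ ε η where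
  geom := S.geom
  width := S.width
  unit' := S.unit'
  unit₀ := S.unit₀
  eps_nonneg := hε
  eta_nonneg := S.eta_nonneg
  tree := S.tree
  plaq := hP
  bond₀ := S.bond₀

variable [NormedAlgebra ℂ 𝔸] [CompleteSpace 𝔸]

open NormedSpace

/-- **p. 382, case 1: "If we take ε = (24R_j⁴)⁻¹δ′_j, then |B′(b)| < δ′_j"** — at object level: in the situation
`Case1Setup`, with `V′(b) = e^{B′(b)}`, `‖B′(b)‖ ≤ 1/2` on the bonds of `P₁∖P₂` ([IV] p. 196 regularity), sides of
`≤ 100MR′` sites (`d ≤ 100MR′`), `R′ ≤ (L + 1)R_j^{1+β₀}`, the `V₀` input `η ≤ K·B₃²B₅M⁶(L⁻¹)^N ε_j`, `ε_j = (A₀/A₁)(p₀/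
p₁)δ′_j`, the printed smallness of the coefficient of `δ′_j` (`≤ 1/4`, with PART 3's `C = 100(2d + 3)(L + 1)K`) and
`(100M(L + 1)R_j^{1+β₀})² ≦ R_j⁴`: IF every plaquette of `V″ = V′V₀` with corners in `P₁∖P₂` deviates from `1` by `≤
(24R_j⁴)⁻¹δ′_j`, THEN every bond `b` with both ends in `P₁∖P₂` has `‖B′(b)‖ < δ′_j` (via `FluctHyp.ineq382V'`,
`prep382_normB_lt` and r13's `B16Sect1Statements.prep382_eps_choice`). [cite: Balaban1989LargeFieldII, p.382] -/
theorem Case1Setup.normB_lt_delta {M R' L Rj β₀ K A₀ A₁ B₃ B₅ p₀g p₁g Linv εj δ'j : ℝ} {N : ℕ}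
    (S : Case1Setup lo hi lo' hi' τ W V' V₀ η) (hP : PlaqSmallOn (ann lo hi lo' hi') (mulCfg V' V₀)
      ((24 * Rj ^ 4)⁻¹ * δ'j)) (B' : Site (n + 3) → Fin (n + 3) → 𝔸)
    (hexp : ∀ x μ, x ∈ ann lo hi lo' hi' → x + e μ ∈ ann lo hi lo' hi' → ((V' x μ : 𝔸ˣ) : 𝔸) = exp (B' x μ))
    (hBsmall : ∀ x μ, x ∈ ann lo hi lo' hi' → x + e μ ∈ ann lo hi lo' hi' → ‖B' x μ‖ ≤ 1 / 2)
    (hD : (W : ℝ) + 1 ≤ 100 * M * R') (hd : (n : ℝ) + 3 ≤ 100 * M * R') (hM : 0 ≤ M)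
    (hRj : R' ≤ (L + 1) * Rj ^ (1 + β₀)) (hRj0 : 0 < Rj) (hδ : 0 < δ'j)
    (hη : η ≤ K * B₃ ^ 2 * B₅ * M ^ 6 * Linv ^ N * εj) (hεj : εj = A₀ / A₁ * (p₀g / p₁g) * δ'j)
    (hsmall : 100 * (2 * ((n : ℝ) + 4) + 1) * (L + 1) * K * (A₀ / A₁) * B₃ ^ 2 * B₅ * M ^ 7 * Rj ^ (1 + β₀) *
      (p₀g / p₁g) * Linv ^ N ≤ 1 / 4)
    (hR4 : (100 * M * (L + 1) * Rj ^ (1 + β₀)) ^ 2 ≤ Rj ^ 4)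
    {x : Site (n + 3)} {μ : Fin (n + 3)} (hx : x ∈ ann lo hi lo' hi') (hx' : x + e μ ∈ ann lo hi lo' hi') :
    ‖B' x μ‖ < δ'j := by
  have hε : 0 < (24 * Rj ^ 4)⁻¹ * δ'j := mul_pos (inv_pos.mpr (by positivity)) hδ
  have hV := (S.fluctHyp hε.le hP).ineq382V' hD hd hM hRj hε hη hεj hx hx'
  have hB : ‖B' x μ‖ ≤ 2 * ‖((V' x μ : 𝔸ˣ) : 𝔸) - 1‖ := by
    rw [hexp x μ hx hx']
    exact norm_le_two_mul_norm_exp_sub_one (hBsmall x μ hx hx')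
  exact B16Sect1Statements.prep382_eps_choice hRj0.ne' (prep382_normB_lt hV hB hsmall hR4 hε.le hδ.le) rfl

/-- **p. 382, case 1, the conclusion: "This implies that at least one plaquette variable has to satisfy the opposite
inequality, i.e., |V″(∂p′) − 1| ≧ (24R_j⁴)⁻¹δ′_j for some p′ ⊂ Ω″^{~2}_{h+1}∖Ω″_{h+1}"** — if some bond `b` with both
ends in `P₁∖P₂` has `‖B′(b)‖ ≥ δ′_j` (the restriction introduced by `1 − χ′`, case 1), then some plaquette `p′ =
(z; κ, ν)` with its four corners in `P₁∖P₂` has `‖V″(∂p′) − 1‖ > (24R_j⁴)⁻¹δ′_j`, `V″ = V′V₀` (hypotheses as in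
`normB_lt_delta`). [cite: Balaban1989LargeFieldII, p.382] -/
theorem Case1Setup.exists_large_plaquette {M R' L Rj β₀ K A₀ A₁ B₃ B₅ p₀g p₁g Linv εj δ'j : ℝ} {N : ℕ}
    (S : Case1Setup lo hi lo' hi' τ W V' V₀ η) (B' : Site (n + 3) → Fin (n + 3) → 𝔸)
    (hexp : ∀ x μ, x ∈ ann lo hi lo' hi' → x + e μ ∈ ann lo hi lo' hi' → ((V' x μ : 𝔸ˣ) : 𝔸) = exp (B' x μ))
    (hBsmall : ∀ x μ, x ∈ ann lo hi lo' hi' → x + e μ ∈ ann lo hi lo' hi' → ‖B' x μ‖ ≤ 1 / 2)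
    (hD : (W : ℝ) + 1 ≤ 100 * M * R') (hd : (n : ℝ) + 3 ≤ 100 * M * R') (hM : 0 ≤ M)
    (hRj : R' ≤ (L + 1) * Rj ^ (1 + β₀)) (hRj0 : 0 < Rj) (hδ : 0 < δ'j)
    (hη : η ≤ K * B₃ ^ 2 * B₅ * M ^ 6 * Linv ^ N * εj) (hεj : εj = A₀ / A₁ * (p₀g / p₁g) * δ'j)
    (hsmall : 100 * (2 * ((n : ℝ) + 4) + 1) * (L + 1) * K * (A₀ / A₁) * B₃ ^ 2 * B₅ * M ^ 7 * Rj ^ (1 + β₀) *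
      (p₀g / p₁g) * Linv ^ N ≤ 1 / 4)
    (hR4 : (100 * M * (L + 1) * Rj ^ (1 + β₀)) ^ 2 ≤ Rj ^ 4)
    {x : Site (n + 3)} {μ : Fin (n + 3)} (hx : x ∈ ann lo hi lo' hi') (hx' : x + e μ ∈ ann lo hi lo' hi')
    (hb : δ'j ≤ ‖B' x μ‖) :
    ∃ (z : Site (n + 3)) (κ ν : Fin (n + 3)), κ ≠ ν ∧ z ∈ ann lo hi lo' hi' ∧ z + e κ ∈ ann lo hi lo' hi' ∧
      z + e ν ∈ ann lo hi lo' hi' ∧ z + e κ + e ν ∈ ann lo hi lo' hi' ∧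
      (24 * Rj ^ 4)⁻¹ * δ'j < ‖((hol (mulCfg V' V₀) z (plaqWord κ ν) : 𝔸ˣ) : 𝔸) - 1‖ := by
  by_contra hcon
  push Not at hcon
  have hP : PlaqSmallOn (ann lo hi lo' hi') (mulCfg V' V₀) ((24 * Rj ^ 4)⁻¹ * δ'j) :=
    fun z κ ν hκν h1 h2 h3 h4 => hcon z κ ν hκν h1 h2 h3 h4
  exact absurd (S.normB_lt_delta hP B' hexp hBsmall hD hd hM hRj hRj0 hδ hη hεj hsmall hR4 hx hx') (not_lt.mpr hb)

end Case1

end Literature.MathematicalPhysics.QuantumFieldTheory.Balaban1983to89.B16Ineq382
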